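import Mathlib
import HarnessLib
import Summits.PneNP.PneNP.Theses.AeaCutRectangles

/-!
# Crux `FoolingMeasure` (stmt-PneNP-19727) — p4 g13, companion to `TypeFloor.lean` / BarrierNotesP4g13 §2bis:
# the PRUNING NORMAL FORM of X1 over arbitrary species — "coverage, not capture"

Seat 1's pruning principle (card `heavy-union-pruning`, `IdeasR2g8.pruningPrinciple_holds`) is stated for the normal-cycle-system universe.
This file records it as an `iff` for X1 itself, over ARBITRARY measures: `foolingMeasure_iff_lightMass`.  X1 holds iff for some `ε` and every
`C`, infinitely often, some probability measure on loopless dark edge sets puts mass `≥ 1/2` on LIGHT members — members `S` such that every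
valid all-dark rectangle at an `ε`-balanced cut having `S` among its unions `α ∪ β` has `μ`-sum `≤ δ_{C+1}`.  (⇐: delete the non-light members,
renormalise; a heavy rectangle consists of non-light unions and weighs `0`, a light one at most `2·δ_{C+1} ≤ δ_C`.  ⇒: under X1 at `C+1` every
member is light.)  CONSEQUENCE for verdicts (BarrierNotesP4g13 §2bis): a rectangle family refutes a SPECIES only if its heavy members COVER
the measure up to mass `< 1/2` (indeed `< 1 − 2^{-O(n)}`, constants go into `C`); a family capturing a vanishing fraction — e.g. the
matching-threshold rectangles on frames, coverage `2^{(1-λ_MT t)n} → 0` — refutes the uniform measure and nothing else.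
FRONTIER material (AEA cut rectangles vs NON-3-COL); nothing here bears on P vs NP.
-/

set_option linter.dupNamespace false
set_option autoImplicit false

namespace Summit.PneNP.PneNP.Cruxes.FoolingMeasure.P4g13.Pruning

open Finset

/-- X1's budget `δ_C(n) = 2^{-(n/2)·log₂ n - C·n}`. -/
noncomputable def budget (n C : ℕ) : ℝ :=
  (2 : ℝ) ^ (-((n : ℝ) / 2 * Real.logb 2 n) - ((C : ℕ) : ℝ) * n)

/-- A VALID rectangle at an `ε`-balanced cut `B` (X1's four side conditions verbatim). -/
def ValidAt {n : ℕ} (ε : ℝ) (B : Finset (Fin n)) (𝓐 𝓑 : Finset (Finset (Sym2 (Fin n)))) : Prop :=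
  (1 / 2 - ε) * (n : ℝ) ≤ B.card ∧ (B.card : ℝ) ≤ (1 / 2 + ε) * n ∧
    (∀ α ∈ 𝓐, ∀ e ∈ α, ¬ e.IsDiag ∧ ∃ v ∈ e, v ∉ B) ∧
    (∀ β ∈ 𝓑, ∀ e ∈ β, ¬ e.IsDiag ∧ ∀ v ∈ e, v ∈ B) ∧
    (∀ α ∈ 𝓐, ∀ β ∈ 𝓑,
      ¬ (SimpleGraph.fromEdgeSet ((α ∪ β : Finset (Sym2 (Fin n))) : Set (Sym2 (Fin n)))).Colorable 3)

/-- The `μ`-sum of a rectangle (X1's left-hand side). -/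
def rectSum {n : ℕ} (μ : Finset (Sym2 (Fin n)) → ℝ) (𝓐 𝓑 : Finset (Finset (Sym2 (Fin n)))) : ℝ :=
  ∑ q ∈ 𝓐 ×ˢ 𝓑, μ (q.1 ∪ q.2)

/-- `S` is LIGHT for `μ` at bound `δ`: every valid rectangle having `S` among its unions has `μ`-sum `≤ δ`. -/
def Light {n : ℕ} (ε : ℝ) (μ : Finset (Sym2 (Fin n)) → ℝ) (δ : ℝ) (S : Finset (Sym2 (Fin n))) : Prop :=
  ∀ (B : Finset (Fin n)) (𝓐 𝓑 : Finset (Finset (Sym2 (Fin n)))), ValidAt ε B 𝓐 𝓑 →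
    (∃ q ∈ 𝓐 ×ˢ 𝓑, q.1 ∪ q.2 = S) → rectSum μ 𝓐 𝓑 ≤ δ

/-- **LIGHT-MASS form of X1**: some probability measure on loopless dark edge sets puts mass `≥ 1/2` on a set of members that
are light at bound `δ_{C+1}`. -/
def LightMassMeasure : Prop :=
  ∃ ε : ℝ, 0 < ε ∧ ε ≤ 1 / 4 ∧ ∀ C : ℕ, ∃ᶠ n in Filter.atTop, ∃ μ : Finset (Sym2 (Fin n)) → ℝ,
    (∀ S, 0 ≤ μ S) ∧ (∑ S, μ S = 1) ∧
    (∀ S, μ S ≠ 0 → (∀ e ∈ S, ¬ e.IsDiag) ∧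
      ¬ (SimpleGraph.fromEdgeSet (S : Set (Sym2 (Fin n)))).Colorable 3) ∧
    ∃ L : Finset (Finset (Sym2 (Fin n))), (∀ S ∈ L, Light ε μ (budget n (C + 1)) S) ∧
      (1 / 2 : ℝ) ≤ ∑ S ∈ L, μ S

/-- `2·δ_{C+1} ≤ δ_C` for `n ≥ 1`. -/
theorem two_mul_budget_succ_le {n : ℕ} (hn : 1 ≤ n) (C : ℕ) : 2 * budget n (C + 1) ≤ budget n C := by
  unfold budget
  have hsplit : (-((n : ℝ) / 2 * Real.logb 2 n) - (((C + 1 : ℕ) : ℕ) : ℝ) * n) =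
      (-((n : ℝ) / 2 * Real.logb 2 n) - ((C : ℕ) : ℝ) * n) + (-(n : ℝ)) := by
    push_cast; ring
  rw [hsplit, Real.rpow_add (by norm_num : (0 : ℝ) < 2), Real.rpow_neg (by norm_num), Real.rpow_natCast]
  have hpos : (0 : ℝ) < (2 : ℝ) ^ (-((n : ℝ) / 2 * Real.logb 2 n) - ((C : ℕ) : ℝ) * n) :=
    Real.rpow_pos_of_pos (by norm_num) _
  have h2n : (2 : ℝ) ≤ (2 : ℝ) ^ n := by
    calc (2 : ℝ) = 2 ^ 1 := by norm_num
      _ ≤ 2 ^ n := pow_le_pow_right₀ (by norm_num) hn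
  have hinv : ((2 : ℝ) ^ n)⁻¹ ≤ 2⁻¹ := inv_anti₀ (by norm_num) h2n
  nlinarith [mul_le_mul_of_nonneg_left hinv hpos.le]

/-- **X1 ⇔ its light-mass form** (pruning normal form over arbitrary species). -/
theorem foolingMeasure_iff_lightMass :
    Summit.PneNP.PneNP.Theses.AeaCutRectangles.FoolingMeasure ↔ LightMassMeasure := by
  constructor
  · -- ⇒ : under X1 at `C+1` every member is light; take `L = univ`.
    rintro ⟨ε, hε0, hε4, hX⟩
    refine ⟨ε, hε0, hε4, fun C => (hX (C + 1)).mono ?_⟩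
    rintro n ⟨μ, hμ, hsum, hs, hR⟩
    refine ⟨μ, hμ, hsum, hs, univ, fun S _ => ?_, by rw [hsum]; norm_num⟩
    intro B 𝓐 𝓑 hV _
    obtain ⟨h1, h2, hA, hB, hD⟩ := hV
    exact hR B h1 h2 𝓐 𝓑 hA hB hD
  · -- ⇐ : prune the non-light members and renormalise.
    rintro ⟨ε, hε0, hε4, hL⟩
    refine ⟨ε, hε0, hε4, fun C => ?_⟩
    have hfreq := (hL C).and_eventually (Filter.eventually_ge_atTop 1)
    refine hfreq.mono ?_
    rintro n ⟨⟨μ, hμ, hsum, hs, L, hLight, hmass⟩, hn⟩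
    set Z : ℝ := ∑ S ∈ L, μ S with hZ
    have hZpos : 0 < Z := by linarith
    -- the pruned, renormalised measure
    let μ' : Finset (Sym2 (Fin n)) → ℝ := fun S => if S ∈ L then μ S / Z else 0
    have hμ'le : ∀ S, μ' S ≤ μ S / Z := by
      intro S
      by_cases h : S ∈ L
      · simp [μ', h]
      · simp [μ', h]; exact div_nonneg (hμ S) hZpos.le
    refine ⟨μ', fun S => ?_, ?_, fun S hS => ?_, ?_⟩
    · by_cases h : S ∈ L
      · simp [μ', h]; exact div_nonneg (hμ S) hZpos.le
      · simp [μ', h]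
    · show ∑ S, (if S ∈ L then μ S / Z else 0) = 1
      rw [Finset.sum_ite_mem, Finset.univ_inter, ← Finset.sum_div, ← hZ, div_self hZpos.ne']
    · have hSL : S ∈ L := by
        by_contra h
        exact hS (by simp [μ', h])
      have hμS : μ S ≠ 0 := by
        intro h0
        exact hS (by simp [μ', hSL, h0])
      exact hs S hμS
    · intro B h1 h2 𝓐 𝓑 hA hB hD
      have hV : ValidAt ε B 𝓐 𝓑 := ⟨h1, h2, hA, hB, hD⟩
      by_cases hheavy : rectSum μ 𝓐 𝓑 ≤ budget n (C + 1)
      · -- light rectangle: termwise domination, factor `1/Z ≤ 2`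
        calc ∑ q ∈ 𝓐 ×ˢ 𝓑, μ' (q.1 ∪ q.2) ≤ ∑ q ∈ 𝓐 ×ˢ 𝓑, μ (q.1 ∪ q.2) / Z :=
              sum_le_sum fun q _ => hμ'le _
          _ = rectSum μ 𝓐 𝓑 / Z := by rw [rectSum, Finset.sum_div]
          _ ≤ budget n (C + 1) / Z := div_le_div_of_nonneg_right hheavy hZpos.le
          _ ≤ budget n (C + 1) / (1 / 2) := by
              apply div_le_div_of_nonneg_left _ (by norm_num) hmass
              unfold budget; exact (Real.rpow_pos_of_pos (by norm_num) _).le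
          _ = 2 * budget n (C + 1) := by ring
          _ ≤ budget n C := two_mul_budget_succ_le hn C
      · -- heavy rectangle: all its unions are non-light, hence pruned
        have hzero : ∀ q ∈ 𝓐 ×ˢ 𝓑, μ' (q.1 ∪ q.2) = 0 := by
          intro q hq
          have hnot : q.1 ∪ q.2 ∉ L := by
            intro hmem
            exact hheavy (hLight _ hmem B 𝓐 𝓑 hV ⟨q, hq, rfl⟩)
          simp [μ', hnot]
        rw [sum_congr rfl hzero, sum_const_zero]
        unfold budget at *
        exact (Real.rpow_pos_of_pos (by norm_num) _).le

/-- **COVERAGE CRITERION** (the contrapositive half, as used in BarrierNotesP4g13 §2bis): to refute X1 along a species it is NOT enough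
that some rectangles are heavy for its natural measure; for every `ε` some `C` must make, for all large `n` and EVERY admissible measure,
the light members weigh `< 1/2`. -/
theorem not_foolingMeasure_iff_lightMass_small :
    ¬ Summit.PneNP.PneNP.Theses.AeaCutRectangles.FoolingMeasure ↔ ¬ LightMassMeasure :=
  not_congr foolingMeasure_iff_lightMass

end Summit.PneNP.PneNP.Cruxes.FoolingMeasure.P4g13.Pruning
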